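import Literature.AlgebraicGeometry.Frobenioids.ArithmeticDivisorsPerfFactorial
import Literature.AlgebraicGeometry.Frobenioids.RealificationDegreeExtension
import HarnessLib

/-!
# Frobenioids I, Ex. 6.3 / Thm. 6.4 (i): the arithmetic degree as an `ℝ_{≥0}`-valued degree on `Φ(L)` and its
# unique extension to `Φ(L)^rlf`

Mochizuki, *The geometry of Frobenioids I*, Kyushu J. Math. **62** (2008), Ex. 6.3 pp. 113–114 (`deg^arith_L`) and
Thm. 6.4 (i) p. 115 l. 27–28: "the homomorphism `(Φ^rlf)^gp(L) = ArithDiv_ℝ(L) → ℝ` given by `deg_L^arith`"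
[cite: MochizukiFrdI2008, Ex. 6.3 p.113] [cite: MochizukiFrdI2008, Thm. 6.4 (i) p.115].

PROOF-ONLY.  The tree's arithmetic degree `arithDegree F : ArithDivisor F →+ ℝ` (seat abc-iut-L1-t3,
`ArithmeticDivisors.lean`) is NONNEGATIVE on effective divisors (`arithDegree_toArithDivisor_nonneg`: `log N(v) ≥ 0`,
`[F_v : ℝ] · t ≥ 0`), hence IS an `ℝ_{≥0}`-valued degree on `Φ(F)` (`exists_nnreal_arithDegree`), and therefore —
`Φ(F)` being perf-factorial (`EffArithDivisor.isPerfFactorial`) — extends UNIQUELY to THE realification `Φ(F)^rlf`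
(`existsUnique_rlf_arithDegree`, via `IsPerfFactorial.Rlf.existsUnique_hom_extending`), `ℝ_{≥0}`-linearly
(`IsPerfFactorial.Rlf.hom_nnreal_rpow`).  The hypothesis "`ℝ` supports `ℝ_{≥0}`" is by name (`hR`; tree:
`supports_R_nnreal`).  Seat abc-iut-L1-d2 (cell abc-iut).
-/

noncomputable section

namespace Literature.AlgebraicGeometry.Frobenioids

open Function NNReal NumberField Literature.AnabelianGeometry.EtaleTheta

variable (F : Type) [Field F] [NumberField F]

/-- **`deg^arith ≥ 0` on effective arithmetic divisors**: each finite place contributes `n · log N(v)` with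
`n ≥ 0`, `N(v) > 1`, each infinite place `[F_v : ℝ] · t` with `t ≥ 0`. [cite: MochizukiFrdI2008, Ex. 6.3 p.113] -/
theorem arithDegree_toArithDivisor_nonneg (D : EffArithDivisor F) : 0 ≤ arithDegree F (EffArithDivisor.toArithDivisor F D) := by
  rw [arithDegree_apply]
  refine add_nonneg (Finsupp.sum_nonneg fun w _ => mul_nonneg ?_ ?_) (Finset.sum_nonneg fun w _ => mul_nonneg ?_ ?_)
  · rw [EffArithDivisor.toArithDivisor_fst]
    exact_mod_cast Nat.zero_le _
  · exact Real.log_nonneg (by exact_mod_cast (NumberField.HeightOneSpectrum.one_lt_absNorm w.maximalIdeal).le)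
  · exact_mod_cast Nat.zero_le _
  · rw [EffArithDivisor.toArithDivisor_snd]
    exact (D.2 w).2

/-- **The arithmetic degree as an `ℝ_{≥0}`-valued degree on `Φ(F)`**: a homomorphism
`d : Φ(F) → ℝ_{≥0}` (multiplicative rendering) with `d(D) = deg^arith(D)`. [cite: MochizukiFrdI2008, Ex. 6.3 p.113] -/
theorem exists_nnreal_arithDegree :
    ∃ d : Multiplicative (EffArithDivisor F) →* Multiplicative ℝ≥0,
      ∀ D : EffArithDivisor F,
        ((Multiplicative.toAdd (d (Multiplicative.ofAdd D)) : ℝ≥0) : ℝ) = arithDegree F (EffArithDivisor.toArithDivisor F D) := by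
  let d₀ : EffArithDivisor F →+ ℝ≥0 :=
    { toFun := fun D => (arithDegree F (EffArithDivisor.toArithDivisor F D)).toNNReal
      map_zero' := by rw [map_zero, map_zero, Real.toNNReal_zero]
      map_add' := fun D E => by
        rw [map_add, map_add, Real.toNNReal_add (arithDegree_toArithDivisor_nonneg F D)
          (arithDegree_toArithDivisor_nonneg F E)] }
  refine ⟨d₀.toMultiplicative, fun D => ?_⟩
  show ((arithDegree F (EffArithDivisor.toArithDivisor F D)).toNNReal : ℝ) = _
  exact Real.coe_toNNReal _ (arithDegree_toArithDivisor_nonneg F D)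

/-- **`deg^arith` extends uniquely to `Φ(F)^rlf`** (Thm. 6.4 (i): "`(Φ^rlf)^gp(L) → ℝ` given by `deg^arith_L`"):
for any `ℝ_{≥0}`-valued degree `d` on the perf-factorial `Φ(F)` there is a unique `φ : Φ(F)^rlf → ℝ_{≥0}` with
`φ ∘ ι = d`; it is `ℝ_{≥0}`-linear (`IsPerfFactorial.Rlf.hom_nnreal_rpow`). [cite: MochizukiFrdI2008, Thm. 6.4 (i) p.115] -/
theorem existsUnique_rlf_arithDegree (hR : Supports (Multiplicative ℝ≥0) MonoidType.R)
    (d : Multiplicative (EffArithDivisor F) →* Multiplicative ℝ≥0) :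
    ∃! φ : (EffArithDivisor.isPerfFactorial F).Rlf →* Multiplicative ℝ≥0,
      φ.comp ((EffArithDivisor.isPerfFactorial F).toRealification.comp (Perfection.of _)) = d :=
  IsPerfFactorial.Rlf.existsUnique_hom_extending (EffArithDivisor.isPerfFactorial F) hR d

end Literature.AlgebraicGeometry.Frobenioids
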